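import Mathlib

/-!
# The three-component mixture, general form: `Dv″ ≥ 0` and route-mass ratios `κ₁, κ₂`
(blind cell PercRepro2, p5 g36; S4 §2.4 (s) addendum 41)

`CrossAPrimeMixtureAlgebra.mixture_nonneg` assumes the core component has `Dv″ = 0` and the
route-mass bounds `xv″ ≤ P₂·u`, `yv″ ≤ P₁·w` (the hard placement `o ∈ V₁`, `b ∈ V₂`).  For the
same-route placement (`o, b ∈ V₁`) the core has `Dv″ = p₂·τ₂ ≥ 0` and `xv″ ≤ p₂·u`, `yv″ ≤ p₂·w`.
**`mixture_nonneg'`** covers both: the core crux `T″ = 2Z″Dv″ − y″xv″ − x″yv″ + π̃x″y″ ≥ 0`,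
`Dv″ ≥ 0`, `xv″ ≤ κ₁·u`, `yv″ ≤ κ₂·w` with `κ₁ + κ₂ ≤ 2π̃`, `xv″ ≤ π̃x″`, `yv″ ≤ π̃y″`, BHK-avoid
`u·w ≤ τ·s`, and the weight condition.  The certificate (`mixture_certificate'`) is that of
`mixture_nonneg` with `A²T″` in place of the old `A²`-term and the extra nonnegative term
`2A(G·Zon + B·s)·Dv″`.  Own work; standard axioms.
-/

namespace Summit.Ventures.PercRepro2.CrossAPrimeMixtureAlgebraGen

variable {R : Type*} [Field R] [LinearOrder R] [IsStrictOrderedRing R]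

omit [LinearOrder R] [IsStrictOrderedRing R] in
/-- The certificate identity behind `mixture_nonneg'` (`pit = P₁ + P₂ − P₁P₂`). -/
lemma mixture_certificate' (A G B C P₁ P₂ Z'' x'' y'' xv'' yv'' Dv'' s u w τ Zon xon yon κ₁ κ₂ : R) :
    2 * (A * Z'' + G * Zon + B * s) * (A * Dv'' + B * τ) -
        (A * y'' + G * yon + B * w) * (A * xv'' + B * u) -
        (A * x'' + G * xon + B * u) * (A * yv'' + B * w) +
        C * (A * x'' + G * xon + B * u) * (A * y'' + G * yon + B * w) =
      A ^ 2 * (2 * Z'' * Dv'' - y'' * xv'' - x'' * yv'' + (P₁ + P₂ - P₁ * P₂) * x'' * y'') +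
        2 * A * (G * Zon + B * s) * Dv'' +
        A * G * ((P₁ + P₂ - P₁ * P₂) * (x'' * yon + xon * y'') - xv'' * yon - yv'' * xon) +
        G ^ 2 * C * (xon * yon) + 2 * G * B * Zon * τ + 2 * A * B * (Z'' - s) * τ +
        2 * A * B * (τ * s - u * w) +
        A * B * (w * (κ₁ * u - xv'') + u * (κ₂ * w - yv'')) +
        B ^ 2 * (2 * (τ * s - u * w)) + B ^ 2 * C * (u * w) +
        A * B * (u * w) * (2 * C - κ₁ - κ₂) +
        ((A * (C - (P₁ + P₂ - P₁ * P₂)) - B * (1 - C)) *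
            (A * (u * (y'' - w) + w * (x'' - u)) + G * (u * yon + w * xon)) +
          A ^ 2 * (C - (P₁ + P₂ - P₁ * P₂)) * (u * w + (x'' - u) * (y'' - w)) +
          A * G * (C - (P₁ + P₂ - P₁ * P₂)) * ((x'' - u) * yon + xon * (y'' - w))) := by
  ring

/-- **The three-component mixture is nonnegative, general form** (see the module docstring). -/
theorem mixture_nonneg' {A G B C P₁ P₂ Z'' x'' y'' xv'' yv'' Dv'' s u w τ Zon xon yon κ₁ κ₂ : R}
    (hA : 0 ≤ A) (hG : 0 ≤ G) (hB : 0 ≤ B)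
    (hP₁ : 0 ≤ P₁) (hP₁' : P₁ ≤ 1) (hP₂ : 0 ≤ P₂)
    (hCpit : P₁ + P₂ - P₁ * P₂ ≤ C)
    (hweight : (1 - C) * B ≤ (C - (P₁ + P₂ - P₁ * P₂)) * A)
    (hs0 : 0 ≤ s) (hs : s ≤ Z'') (hu0 : 0 ≤ u) (hw0 : 0 ≤ w) (hτ0 : 0 ≤ τ) (hDv : 0 ≤ Dv'')
    (hxu : u ≤ x'') (hyw : w ≤ y'')
    (hκ : κ₁ + κ₂ ≤ 2 * (P₁ + P₂ - P₁ * P₂))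
    (hxv : xv'' ≤ κ₁ * u) (hyv : yv'' ≤ κ₂ * w)
    (hxvπ : xv'' ≤ (P₁ + P₂ - P₁ * P₂) * x'') (hyvπ : yv'' ≤ (P₁ + P₂ - P₁ * P₂) * y'')
    (hbhk : u * w ≤ τ * s)
    (htwo : 0 ≤ 2 * Z'' * Dv'' - y'' * xv'' - x'' * yv'' + (P₁ + P₂ - P₁ * P₂) * x'' * y'')
    (hZon : 0 ≤ Zon) (hxon : 0 ≤ xon) (hyon : 0 ≤ yon) :
    0 ≤ 2 * (A * Z'' + G * Zon + B * s) * (A * Dv'' + B * τ) -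
        (A * y'' + G * yon + B * w) * (A * xv'' + B * u) -
        (A * x'' + G * xon + B * u) * (A * yv'' + B * w) +
        C * (A * x'' + G * xon + B * u) * (A * y'' + G * yon + B * w) := by
  rw [mixture_certificate' A G B C P₁ P₂ Z'' x'' y'' xv'' yv'' Dv'' s u w τ Zon xon yon κ₁ κ₂]
  set pit := P₁ + P₂ - P₁ * P₂ with hpit
  have hpit0 : 0 ≤ pit := by
    have := mul_nonneg hP₂ (sub_nonneg.2 hP₁')
    rw [hpit]; linarith
  have hC0 : 0 ≤ C := by linarith
  have h2C : 0 ≤ 2 * C - κ₁ - κ₂ := by linarith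
  have hCp : 0 ≤ C - pit := by linarith
  have hxv_ : 0 ≤ x'' - u := by linarith
  have hyv_ : 0 ≤ y'' - w := by linarith
  have hW : 0 ≤ A * (C - pit) - B * (1 - C) := by linarith
  have t1 : 0 ≤ A ^ 2 * (2 * Z'' * Dv'' - y'' * xv'' - x'' * yv'' + pit * x'' * y'') :=
    mul_nonneg (sq_nonneg _) htwo
  have t1' : 0 ≤ 2 * A * (G * Zon + B * s) * Dv'' :=
    mul_nonneg (mul_nonneg (mul_nonneg (by norm_num) hA)
      (add_nonneg (mul_nonneg hG hZon) (mul_nonneg hB hs0))) hDv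
  have t2 : 0 ≤ A * G * (pit * (x'' * yon + xon * y'') - xv'' * yon - yv'' * xon) := by
    refine mul_nonneg (mul_nonneg hA hG) ?_
    have a1 : xv'' * yon ≤ pit * x'' * yon := mul_le_mul_of_nonneg_right hxvπ hyon
    have a2 : yv'' * xon ≤ pit * y'' * xon := mul_le_mul_of_nonneg_right hyvπ hxon
    have e : pit * (x'' * yon + xon * y'') - xv'' * yon - yv'' * xon =
        (pit * x'' * yon - xv'' * yon) + (pit * y'' * xon - yv'' * xon) := by ring
    rw [e]
    exact add_nonneg (by linarith) (by linarith)
  have t3 : 0 ≤ G ^ 2 * C * (xon * yon) :=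
    mul_nonneg (mul_nonneg (sq_nonneg _) hC0) (mul_nonneg hxon hyon)
  have t4 : 0 ≤ 2 * G * B * Zon * τ :=
    mul_nonneg (mul_nonneg (mul_nonneg (mul_nonneg (by norm_num) hG) hB) hZon) hτ0
  have t5 : 0 ≤ 2 * A * B * (Z'' - s) * τ :=
    mul_nonneg (mul_nonneg (mul_nonneg (mul_nonneg (by norm_num) hA) hB) (by linarith)) hτ0
  have t6 : 0 ≤ 2 * A * B * (τ * s - u * w) :=
    mul_nonneg (mul_nonneg (mul_nonneg (by norm_num) hA) hB) (by linarith)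
  have t7 : 0 ≤ A * B * (w * (κ₁ * u - xv'') + u * (κ₂ * w - yv'')) := by
    refine mul_nonneg (mul_nonneg hA hB) ?_
    have a3 : 0 ≤ w * (κ₁ * u - xv'') := mul_nonneg hw0 (by linarith)
    have a4 : 0 ≤ u * (κ₂ * w - yv'') := mul_nonneg hu0 (by linarith)
    linarith
  have t8 : 0 ≤ B ^ 2 * (2 * (τ * s - u * w)) := mul_nonneg (sq_nonneg _) (by linarith)
  have t9 : 0 ≤ B ^ 2 * C * (u * w) :=
    mul_nonneg (mul_nonneg (sq_nonneg _) hC0) (mul_nonneg hu0 hw0)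
  have t10 : 0 ≤ A * B * (u * w) * (2 * C - κ₁ - κ₂) :=
    mul_nonneg (mul_nonneg (mul_nonneg hA hB) (mul_nonneg hu0 hw0)) h2C
  have t11 : 0 ≤ (A * (C - pit) - B * (1 - C)) *
      (A * (u * (y'' - w) + w * (x'' - u)) + G * (u * yon + w * xon)) := by
    refine mul_nonneg hW ?_
    have a5 : 0 ≤ A * (u * (y'' - w) + w * (x'' - u)) :=
      mul_nonneg hA (add_nonneg (mul_nonneg hu0 hyv_) (mul_nonneg hw0 hxv_))
    have a6 : 0 ≤ G * (u * yon + w * xon) :=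
      mul_nonneg hG (add_nonneg (mul_nonneg hu0 hyon) (mul_nonneg hw0 hxon))
    linarith
  have t12 : 0 ≤ A ^ 2 * (C - pit) * (u * w + (x'' - u) * (y'' - w)) :=
    mul_nonneg (mul_nonneg (sq_nonneg _) hCp)
      (add_nonneg (mul_nonneg hu0 hw0) (mul_nonneg hxv_ hyv_))
  have t13 : 0 ≤ A * G * (C - pit) * ((x'' - u) * yon + xon * (y'' - w)) :=
    mul_nonneg (mul_nonneg (mul_nonneg hA hG) hCp)
      (add_nonneg (mul_nonneg hxv_ hyon) (mul_nonneg hxon hyv_))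
  exact add_nonneg (add_nonneg (add_nonneg (add_nonneg (add_nonneg (add_nonneg (add_nonneg
    (add_nonneg (add_nonneg (add_nonneg (add_nonneg t1 t1') t2) t3) t4) t5) t6) t7) t8) t9) t10)
    (add_nonneg (add_nonneg t11 t12) t13)

end Summit.Ventures.PercRepro2.CrossAPrimeMixtureAlgebraGen
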